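import Summits.ValiantsHypothesis.ValiantsHypothesis.Theorems.KPlusLogSqLawTridiagonalRealStaticDoubling

/-!
# Route «KPlusLogSqLaw», crux `WeakLifting` (stmt-ValiantsHypothesis-19561) — REAL side of the tridiagonal sector:
# the DOUBLING LAW WITH THE FAR-LEFT TRANSITION — `B(2m) ≥ 2Z + 1` from every certified `Z`-row (all sizes)

HONEST FRAMING.  Helper (`--supports stmt-ValiantsHypothesis-19561 --as helper`), seat val-sym-lift-p3 (g14), cell `pub-symmetroid`, 2026-08-28,
α register (static definite symmetric tridiagonal monomial designs), LOWER side.  The g13 file `…TridiagonalRealStaticDoubling` proves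
`double_row`: gluing a block of size `n + 1` to its mirror image (exponents raised by `s`) through one constant link `β` gives the determinant
`X^{ns} · (X^s · D_{n+1}² − β² · D_n²)` (`pathDet_double`), which alternates along `2Z + 1` points when `D_{n+1}` is certified to alternate along
`Z + 1` points — `2Z` zeros.  The seat's ROWS (`…TenFifteen`, `…TwelveNineteen`, `…FourteenTwentyThree`) have ONE MORE zero: far to the left the
constant coupling `β² D_n²` beats `X^s D_{n+1}²`, so the doubled determinant is NEGATIVE near `0⁺` while it is positive at the first certificate
point.  This file formalises that transition by the ORDER OF VANISHING AT `0`: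
* `eval_neg_near_zero` — if `P, Q ≠ 0` and `2·ord₀(Q) < s + 2·ord₀(P)` (`ord₀ = rootMultiplicity 0`), then for every `β ≠ 0` the polynomial
  `X^s P² − β² Q²` is negative on some interval `(0, δ)`, `δ > 0` (write `P = X^p P₁`, `Q = X^q Q₁` with `P₁(0), Q₁(0) ≠ 0`);
* `double_row_succ` — THE SHARP DOUBLING LAW: under the hypotheses of `double_row` plus `D_n ≠ 0` and `2·ord₀(D_n) < s + 2·ord₀(D_{n+1})`, the
  doubled design of size `2n + 2` has at least `2Z + 1` distinct positive determinant zeros;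
* `double_row_succ_exists` — since the shift `s` is free, `D_n ≠ 0` alone gives a shift `s` and a coupling `β > 0` with `2Z + 1` zeros:
  **`B(2m) ≥ 2Z + 1` from every certified `Z`-row of size `m` whose block minus its last vertex has a nonzero determinant.**
Nothing here is an upper bound; nothing bears on `WeakLifting` / `TropicalB` (stmt-19771) in their windows, Conjecture B, the Door-A registers,
`MatrixDescartes` (stmt-ValiantsHypothesis-18050) or VP ≠ VNP.
[mechanism: val-sym-lift-p3 g13's symmetric doubling (memo SEED-AND-SWITCH-liftp3g13.md §3); folklore: order of vanishing, intermediate values]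
-/

-- `Summit.ValiantsHypothesis.ValiantsHypothesis.…` repeats a component by the D-0017 layout (single-conjunct summit); the name is mandated.
set_option linter.dupNamespace false
set_option autoImplicit false

namespace Summit.ValiantsHypothesis.ValiantsHypothesis.Theorems.KPlusLogSqLaw.StaticTridiagonalRealDoubling

open Polynomial Filter Topology
open Summit.ValiantsHypothesis.ValiantsHypothesis.Theorems.KPlusLogSqLaw.StaticTridiagonalRealPotential
  (pathDet eval_pathDet_succ_ne_zero)
open Summit.ValiantsHypothesis.ValiantsHypothesis.Theorems.KPlusLogSqLaw.StaticTridiagonalRealLadder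
  (le_card_posRoots_of_isChain ne_zero_of_isChain_alt)

/-! ### §1 Order of vanishing at `0` and the sign near `0⁺` -/

/-- Factor out the order of vanishing at `0`: a nonzero real polynomial is `X^{ord₀} · P₁` with `P₁(0) ≠ 0`. [folklore] -/
theorem exists_eq_X_pow_mul_eval_ne_zero (P : ℝ[X]) (hP : P ≠ 0) :
    ∃ P₁ : ℝ[X], P = X ^ P.rootMultiplicity 0 * P₁ ∧ P₁.eval 0 ≠ 0 := by
  obtain ⟨P₁, hP₁, hndvd⟩ := exists_eq_pow_rootMultiplicity_mul_and_not_dvd P hP 0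
  refine ⟨P₁, by simpa using hP₁, fun h0 => hndvd ?_⟩
  rw [map_zero, sub_zero, X_dvd_iff, coeff_zero_eq_eval_zero]
  exact h0

/-- **Sign near `0⁺` by order of vanishing.**  If `P, Q ≠ 0`, `β ≠ 0` and `2·ord₀(Q) < s + 2·ord₀(P)`, then `x^s P(x)² − β² Q(x)² < 0` for all
`x` in some interval `(0, δ)`, `δ > 0`. [folklore] -/
theorem eval_neg_near_zero (P Q : ℝ[X]) (hP : P ≠ 0) (hQ : Q ≠ 0) (s : ℕ) {β : ℝ} (hβ : β ≠ 0)
    (hord : 2 * Q.rootMultiplicity 0 < s + 2 * P.rootMultiplicity 0) :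
    ∃ δ : ℝ, 0 < δ ∧ ∀ x : ℝ, 0 < x → x < δ → x ^ s * P.eval x ^ 2 - β ^ 2 * Q.eval x ^ 2 < 0 := by
  obtain ⟨P₁, hP₁, hP₁0⟩ := exists_eq_X_pow_mul_eval_ne_zero P hP
  obtain ⟨Q₁, hQ₁, hQ₁0⟩ := exists_eq_X_pow_mul_eval_ne_zero Q hQ
  set p := P.rootMultiplicity 0 with hp
  set q := Q.rootMultiplicity 0 with hq
  -- the reduced comparison `g(x) = x^{s + 2p − 2q} P₁(x)² − β² Q₁(x)²` is continuous and negative at `0`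
  set g : ℝ → ℝ := fun x => x ^ (s + 2 * p - 2 * q) * P₁.eval x ^ 2 - β ^ 2 * Q₁.eval x ^ 2 with hg
  have hgc : Continuous g := by
    have h1 : Continuous fun x : ℝ => P₁.eval x := Polynomial.continuous _
    have h2 : Continuous fun x : ℝ => Q₁.eval x := Polynomial.continuous _
    exact ((continuous_pow _).mul (h1.pow 2)).sub (continuous_const.mul (h2.pow 2))
  have hg0 : g 0 < 0 := by
    have hk : s + 2 * p - 2 * q ≠ 0 := by omega
    simp only [hg, zero_pow hk, zero_mul, zero_sub, neg_lt_zero]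
    positivity
  obtain ⟨δ, hδ, hδg⟩ := Metric.eventually_nhds_iff.mp (hgc.continuousAt.eventually_lt continuousAt_const hg0)
  refine ⟨δ, hδ, fun x hx hxδ => ?_⟩
  have hgx : g x < 0 := hδg (by rw [Real.dist_eq, sub_zero, abs_of_pos hx]; exact hxδ)
  -- `x^s P² − β² Q² = x^{2q} · g(x)` for `x ≠ 0`
  have hPx : P.eval x = x ^ p * P₁.eval x := by
    conv_lhs => rw [hP₁]
    simp only [eval_mul, eval_pow, eval_X]
  have hQx : Q.eval x = x ^ q * Q₁.eval x := by
    conv_lhs => rw [hQ₁]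
    simp only [eval_mul, eval_pow, eval_X]
  have hfac : x ^ s * P.eval x ^ 2 - β ^ 2 * Q.eval x ^ 2 = x ^ (2 * q) * g x := by
    rw [hPx, hQx, hg]
    simp only
    have e0 : x ^ (s + 2 * p) = x ^ (2 * q) * x ^ (s + 2 * p - 2 * q) := by
      rw [← pow_add]; congr 1; omega
    have e1 : x ^ s * (x ^ p * eval x P₁) ^ 2 = x ^ (2 * q) * (x ^ (s + 2 * p - 2 * q) * eval x P₁ ^ 2) := by
      rw [show x ^ s * (x ^ p * eval x P₁) ^ 2 = x ^ (s + 2 * p) * eval x P₁ ^ 2 by ring, e0]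
      ring
    rw [e1]
    ring
  rw [hfac]
  exact mul_neg_of_pos_of_neg (pow_pos hx _) hgx

/-! ### §2 The sharp doubling law -/

/-- **THE SHARP DOUBLING LAW (all sizes, `2Z + 1`).**  If the links of the block `(a, d, b, f)` are nonzero, its top continuant `D_{n+1}`
alternates in sign along a strictly increasing list `τ :: τ' :: L` of positive points (`Z = |L| + 1 ≥ 1` certified zeros), `D_n ≠ 0`, and the
shift `s` satisfies `2·ord₀(D_n) < s + 2·ord₀(D_{n+1})`, then there is a coupling `β > 0` such that the doubled design of size `2n + 2`
(`pathDet_double`) has at least `2Z + 1 = 2|L| + 3` distinct positive determinant zeros: the `2Z` of `double_row` (old points positive, zeros of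
`D_{n+1}` between them negative) plus ONE far-left transition, the determinant being negative near `0⁺` (`eval_neg_near_zero`) and positive at
`τ`. [this seat] -/
theorem double_row_succ (a : ℕ → ℝ) (d : ℕ → ℕ) (b : ℕ → ℝ) (f : ℕ → ℕ) (hb : ∀ t, b t ≠ 0) (n s : ℕ) (τ τ' : ℝ) (L : List ℝ)
    (hlt : (τ :: τ' :: L).IsChain (· < ·)) (hpos : ∀ u ∈ τ :: τ' :: L, 0 < u)
    (halt : (τ :: τ' :: L).IsChain (fun x y => (pathDet a d b f (n + 1)).eval x * (pathDet a d b f (n + 1)).eval y < 0))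
    (hQ : pathDet a d b f n ≠ 0)
    (hord : 2 * (pathDet a d b f n).rootMultiplicity 0 < s + 2 * (pathDet a d b f (n + 1)).rootMultiplicity 0) :
    ∃ β : ℝ, 0 < β ∧ 2 * L.length + 3 ≤
      ((pathDet (fun t => if t ≤ n then a t else a (2 * n + 1 - t)) (fun t => if t ≤ n then d t else d (2 * n + 1 - t) + s)
        (fun t => if t < n then b t else if t = n then β else b (2 * n - t))
        (fun t => if t < n then f t else if t = n then 0 else f (2 * n - t) + s) (2 * n + 2)).roots.toFinset.filter
          (fun t => 0 < t)).card := by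
  -- nonvanishing of `D_{n+1}` at the certificate points, hence `D_{n+1} ≠ 0`
  have hne : ∀ u ∈ τ :: τ' :: L, (pathDet a d b f (n + 1)).eval u ≠ 0 := ne_zero_of_isChain_alt halt
  have hP : pathDet a d b f (n + 1) ≠ 0 := by
    intro h0; have := hne τ (by simp); rw [h0, eval_zero] at this; exact this rfl
  -- the coupling (as in `double_row`)
  obtain ⟨β, hβ, hβL⟩ := exists_small_coupling (fun x => (pathDet a d b f (n + 1)).eval x)
    (fun x => (pathDet a d b f n).eval x) s (τ :: τ' :: L) (fun u hu => ⟨hpos u hu, hne u hu⟩)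
  refine ⟨β, hβ, ?_⟩
  -- the doubled determinant at a real point
  have hev : ∀ x : ℝ, (pathDet (fun t => if t ≤ n then a t else a (2 * n + 1 - t))
      (fun t => if t ≤ n then d t else d (2 * n + 1 - t) + s)
      (fun t => if t < n then b t else if t = n then β else b (2 * n - t))
      (fun t => if t < n then f t else if t = n then 0 else f (2 * n - t) + s) (2 * n + 2)).eval x =
      x ^ (n * s) * (x ^ s * (pathDet a d b f (n + 1)).eval x ^ 2 - β ^ 2 * (pathDet a d b f n).eval x ^ 2) := by
    intro x
    rw [pathDet_double]
    simp only [eval_mul, eval_sub, eval_pow, eval_X, eval_C]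
  -- signs: positive at the certificate points, negative at the positive zeros of `D_{n+1}`
  have hEpos : ∀ u ∈ τ :: τ' :: L, 0 < u ∧
      0 < u ^ (n * s) * (u ^ s * (pathDet a d b f (n + 1)).eval u ^ 2 - β ^ 2 * (pathDet a d b f n).eval u ^ 2) := by
    intro u hu
    have hu0 : 0 < u := hpos u hu
    have h := hβL u hu
    refine ⟨hu0, mul_pos (pow_pos hu0 _) ?_⟩
    linarith [h]
  have hEneg : ∀ r : ℝ, 0 < r → (pathDet a d b f (n + 1)).eval r = 0 →
      r ^ (n * s) * (r ^ s * (pathDet a d b f (n + 1)).eval r ^ 2 - β ^ 2 * (pathDet a d b f n).eval r ^ 2) < 0 := by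
    intro r hr hPr
    have hQr : (pathDet a d b f n).eval r ≠ 0 := fun hQr => eval_pathDet_succ_ne_zero a d b f hb hr n hQr hPr
    rw [hPr]
    have hQ2 : 0 < (pathDet a d b f n).eval r ^ 2 := by positivity
    have : r ^ s * (0 : ℝ) ^ 2 - β ^ 2 * (pathDet a d b f n).eval r ^ 2 < 0 := by
      have := mul_pos (pow_pos hβ 2) hQ2
      simp only [ne_eq, OfNat.ofNat_ne_zero, not_false_eq_true, zero_pow, mul_zero, zero_sub, Left.neg_neg_iff]
      exact this
    exact mul_neg_of_pos_of_neg (pow_pos hr _) this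
  -- interleave the zeros (g13's `exists_interleave`)
  obtain ⟨L', hlen, hlt', hpos', halt'⟩ := exists_interleave (fun x => (pathDet a d b f (n + 1)).eval x)
    (fun x => x ^ (n * s) * (x ^ s * (pathDet a d b f (n + 1)).eval x ^ 2 - β ^ 2 * (pathDet a d b f n).eval x ^ 2))
    (Polynomial.continuous _) hEneg (τ' :: L) τ hlt hEpos halt
  -- the far-left transition: a point `x₀ ∈ (0, τ)` where the doubled determinant is negative
  obtain ⟨δ, hδ, hδneg⟩ := eval_neg_near_zero (pathDet a d b f (n + 1)) (pathDet a d b f n) hP hQ s hβ.ne' hord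
  have hτ : 0 < τ := hpos τ (by simp)
  set x₀ : ℝ := min (δ / 2) (τ / 2) with hx₀
  have hx₀pos : 0 < x₀ := lt_min (by linarith) (by linarith)
  have hx₀δ : x₀ < δ := (min_le_left _ _).trans_lt (by linarith)
  have hx₀τ : x₀ < τ := (min_le_right _ _).trans_lt (by linarith)
  have hEx₀ : x₀ ^ (n * s) * (x₀ ^ s * (pathDet a d b f (n + 1)).eval x₀ ^ 2 - β ^ 2 * (pathDet a d b f n).eval x₀ ^ 2) < 0 :=
    mul_neg_of_pos_of_neg (pow_pos hx₀pos _) (hδneg x₀ hx₀pos hx₀δ)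
  -- the full alternation list `x₀ :: τ :: L'`
  have hchain : (x₀ :: τ :: L').IsChain (fun x y =>
      (pathDet (fun t => if t ≤ n then a t else a (2 * n + 1 - t)) (fun t => if t ≤ n then d t else d (2 * n + 1 - t) + s)
        (fun t => if t < n then b t else if t = n then β else b (2 * n - t))
        (fun t => if t < n then f t else if t = n then 0 else f (2 * n - t) + s) (2 * n + 2)).eval x *
      (pathDet (fun t => if t ≤ n then a t else a (2 * n + 1 - t)) (fun t => if t ≤ n then d t else d (2 * n + 1 - t) + s)
        (fun t => if t < n then b t else if t = n then β else b (2 * n - t))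
        (fun t => if t < n then f t else if t = n then 0 else f (2 * n - t) + s) (2 * n + 2)).eval y < 0) := by
    refine List.isChain_cons_cons.mpr ⟨?_, ?_⟩
    · rw [hev x₀, hev τ]
      exact mul_neg_of_neg_of_pos hEx₀ (hEpos τ (by simp)).2
    · refine List.IsChain.imp (fun x y (hxy : _ < 0) => ?_) halt'
      rw [hev x, hev y]
      exact hxy
  have hltall : (x₀ :: τ :: L').IsChain (· < ·) := List.isChain_cons_cons.mpr ⟨hx₀τ, hlt'⟩
  have hposall : ∀ u ∈ x₀ :: τ :: L', 0 < u := by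
    intro u hu
    rcases List.mem_cons.mp hu with rfl | hu
    · exact hx₀pos
    · exact hpos' u hu
  have hcount := le_card_posRoots_of_isChain _ (x₀ :: τ :: L') hltall hposall hchain
  simp only [List.length_cons] at hcount hlen ⊢
  omega

/-- **`B(2m) ≥ 2Z + 1` (the shift is free).**  If the links of the block are nonzero, `D_{n+1}` alternates in sign along a strictly increasing
list `τ :: τ' :: L` of positive points (`Z = |L| + 1` certified zeros) and `D_n ≠ 0`, then for the shift `s = 2·ord₀(D_n) + 1` and a suitable
coupling `β > 0` the doubled design of size `2n + 2` has at least `2Z + 1` distinct positive determinant zeros. [this seat] -/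
theorem double_row_succ_exists (a : ℕ → ℝ) (d : ℕ → ℕ) (b : ℕ → ℝ) (f : ℕ → ℕ) (hb : ∀ t, b t ≠ 0) (n : ℕ) (τ τ' : ℝ)
    (L : List ℝ) (hlt : (τ :: τ' :: L).IsChain (· < ·)) (hpos : ∀ u ∈ τ :: τ' :: L, 0 < u)
    (halt : (τ :: τ' :: L).IsChain (fun x y => (pathDet a d b f (n + 1)).eval x * (pathDet a d b f (n + 1)).eval y < 0))
    (hQ : pathDet a d b f n ≠ 0) :
    ∃ (s : ℕ) (β : ℝ), 0 < β ∧ 2 * L.length + 3 ≤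
      ((pathDet (fun t => if t ≤ n then a t else a (2 * n + 1 - t)) (fun t => if t ≤ n then d t else d (2 * n + 1 - t) + s)
        (fun t => if t < n then b t else if t = n then β else b (2 * n - t))
        (fun t => if t < n then f t else if t = n then 0 else f (2 * n - t) + s) (2 * n + 2)).roots.toFinset.filter
          (fun t => 0 < t)).card :=
  ⟨2 * (pathDet a d b f n).rootMultiplicity 0 + 1,
    double_row_succ a d b f hb n _ τ τ' L hlt hpos halt hQ (by omega)⟩

end Summit.ValiantsHypothesis.ValiantsHypothesis.Theorems.KPlusLogSqLaw.StaticTridiagonalRealDoubling
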